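import Literature.NumberTheory.Automorphic.TotallyRealNonModularImages
import Literature.NumberTheory.Automorphic.CaraianiNewtonModularityProofs
import HarnessLib

/-!
# Modularity over totally real fields not containing `√5`: Thorne's `5`-isogeny theorem and the
# reduction to the `F`-points of `X₀(15)` and `X(s3, b5)` (Thorne 2016, Thm. 7.6; Thorne 2019,
# Thm. 2, Lemma 3, Prop. 4)

Topic `Literature/NumberTheory/Automorphic`; companion of `TotallyRealModularity.lean` (rendering
of "modular" = `IsAutomorphicOfWeightZero E`, module docstring "Rendering and faithfulness"),
`FreitasLeHungSiksekLifting.lean` (`FLS2015_theorems3_4`), `TotallyRealModularityBoxImages.lean`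
(`Box2022_theorem1_3`), `TotallyRealNonModularImages.lean` (the weak trace-only rendering
`IsModularEllipticCurve`) and `CaraianiNewtonModularityProofs.lean` (the models of `X₀(15)` and
`X(s3, b5)`). Requested (ledger `wi-36844`) by route `Langlands/HeptagonalTower`, crux
`OddDegreeDoor` (stmt-Langlands-16840): the printed inputs turning "every `K`-point of `X₀(15)`
is one of the eight rational ones" into "every elliptic curve over `K` is modular" for totally
real `K` with `√5 ∉ K`.

## Sources and what is printed (quoted from the held texts)

* J. A. Thorne, *Automorphy of some residually dihedral Galois representations*, Math. Ann. 364
  (2016) 589–648 = arXiv:1504.00994 [Thorne2016], **Theorem 7.6** (= Thm. 1.1; p. 37 of the held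
  text `paper:arxiv-1504.00994`): "Let `F` be a totally real number field, and let `E` be an
  elliptic curve over `F`. Suppose that: 5 is not a square in `F`; and `E` has no `F`-rational
  5-isogeny. Then `E` is modular."  Proof, ibid.: "The condition that `E` has no `F`-rational
  5-isogeny is equivalent to the assertion that `ρ̄` is irreducible […]. If `ρ̄|_{G_{F(ζ₅)}}` is
  absolutely irreducible, then `ρ` is automorphic by [Fre13]. […] The hypotheses of Theorem
  [1.2, his automorphy theorem for residually dihedral `ρ`] are now satisfied".  "modular" (§1): "for any prime `p`, the 2-dimensional Galois
  representation associated to the first étale cohomology group `H¹(E_{F̄}, ℚ̄_p)` is automorphic"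
  (Thm. 1.2: "there exists a cuspidal automorphic representation `π` of `GL₂(𝔸_F)` of weight 2 and
  an isomorphism `ι : ℚ̄_p → ℂ` such that `ρ ≅ r_ι(π)`").
* J. A. Thorne, *Elliptic curves over `ℚ_∞` are modular*, J. Eur. Math. Soc. 21 (2019) 1943–1948
  = arXiv:1505.04769 [Thorne2019] (held text `paper:arxiv-1505.04769`, §2):
  - **Theorem 2.** "Let `E` be an elliptic curve over a totally real number field `F`, and
    suppose that (at least) one of the following is true: The representation
    `ρ̄_{E,3}|_{G_{F(ζ₃)}}` is absolutely irreducible. `√5 ∉ F`, and `ρ̄_{E,5}` is irreducible.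
    Then `E` is modular."  (Proof: "The first part follows from results of Kisin and
    Langlands–Tunnell, see [Fre13]. […] The second part in the remaining case is [Tho15].")
  - **Lemma 3.** "Let `F` be a totally real field such that `√5 ∉ F`. (1) If `E` is an elliptic
    curve over `F` which is not modular, then `E` determines an `F`-rational point of one of the
    curves `X(s3, b5)`, `X(b3, b5)`. (2) If `F/ℚ` is cyclic and `X(s3, b5)(F) = X(s3, b5)(ℚ)`,
    `X(b3, b5)(F) = X(b3, b5)(ℚ)`, then all elliptic curves over `F` are modular."  (Proof: "The
    first part is a consequence of Theorem 2 and [Fre13]. The second part is a consequence of the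
    first part, the modularity of all elliptic curves over `ℚ`, and cyclic base change for `GL₂`
    [Lan80].")
  - **Proposition 4.** "The curve `X(b3, b5)` is isomorphic over `ℚ` to the elliptic curve
    `E₁ : y² + xy + y = x³ + x² - 10x - 10` of Cremona label 15A1. The curve `X(s3, b5)` is
    isomorphic over `ℚ` to the elliptic curve `E₂ : y² + xy + y = x³ + x² - 5x + 2` of Cremona
    label 15A3. Both curves have group of rational points isomorphic to `ℤ/2ℤ ⊕ ℤ/4ℤ`. They are
    related by an isogeny of degree 2." (Proof: "See [Fre13].")
  - "modular" (§1): "there is a regular algebraic automorphic representation `π` of `GL₂(𝔸_F)`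
    which has the same `L`-function as `E`".

## Contents and rendering

* `not_hasIrreducibleModPGaloisRep_of_isTorsionGaloisRep_borel` (proved): a framing of `E[p]`
  with upper-triangular image exhibits the `Γ`-stable line `{P ; e(P)₂ = 0}`, so `E[p]` is not
  irreducible (`WeierstrassCurve.HasIrreducibleModPGaloisRep`, `GaloisAction.lean`). This is the
  dictionary "`E` has an `F`-rational `5`-isogeny ⇔ `ρ̄_{E,5}` reducible ⇔ conjugate into `B(5)`"
  in the direction needed here.
* `Thorne2016_theorem7_6` is a THEOREM of the tree, not a new named fact: Box 2022, Thm. 1.3 (ii)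
  (`Box2022_theorem1_3`, whose printed proof is "(ii) Thorne 2016") is its contrapositive on the
  tree's carriers, so Thm. 7.6 is recovered from that fact and the dictionary lemma — same unit of
  debt, no restatement. Rendering: `F` totally real number field, "5 is not a square in `F`" =
  `¬ IsSquare (5 : F)` (as in `Box2022_theorem1_1/1_3`), "no `F`-rational 5-isogeny" =
  `(E.baseChange F).HasIrreducibleModPGaloisRep 5` (the source's own equivalence, quoted above),
  "modular" = `IsAutomorphicOfWeightZero E` for an integral model `E / 𝓞 F` with `Δ(E) ≠ 0`.
* `Thorne2019_theorem2` is likewise a THEOREM from `FLS2015_theorems3_4` (first bullet, `p = 3`: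
  `ModPImageAbsIrreducibleOverCyclotomic (E.baseChange F) 3`, the tree's rendering of
  "`ρ̄_{E,3}|_{G_{F(ζ₃)}}` absolutely irreducible") and `Thorne2016_theorem7_6` (second bullet).
* `Thorne2019.curveE1 = ⟨1, 1, 1, -10, -10⟩` and `Thorne2019.curveE2 = ⟨1, 1, 1, -5, 2⟩` are the
  printed equations `E₁`, `E₂` of Prop. 4 (the tree already knows `Δ(E₁) = 50625 = 3⁴5⁴`,
  `Δ(E₂) = 225`, and that `E₁` is `ℚ`-isomorphic to the Legendre model `X0FifteenLegendre` of
  `X₀(15)` by `(u, r, s, t) = (2, -12, 1, 4)`: `cremona15a1_Δ`, `cremona15a3_Δ`,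
  `variableChange_X0FifteenLegendre_eq_cremona15a1`, file `CaraianiNewtonModularityProofs`).
* `Thorne2019_lemma3_2` — the ONE named fact of this file (D-0014): Lemma 3 (2) with the
  identifications of Prop. 4 substituted, i.e. for `F` totally real, `√5 ∉ F`, `F/ℚ` cyclic
  (`IsGalois ℚ F ∧ IsCyclic (F ≃ₐ[ℚ] F)`), if every `F`-point of `E₁` and of `E₂` is `ℚ`-rational
  (every affine point of the base change has both coordinates in the image of `ℚ`; the point at
  infinity is rational) then every integral Weierstrass model over `𝓞 F` with `Δ ≠ 0` is
  automorphic of weight zero. `X(b3,b5)(F) = X(b3,b5)(ℚ)` is `E₁(F) = E₁(ℚ)` because a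
  `ℚ`-isomorphism `X(b3,b5) ≅ E₁` (Prop. 4) is a bijection on `F`-points respecting
  `ℚ`-rationality; likewise for `E₂`. Lemma 3 (1) is NOT vendored separately: "`E` determines an
  `F`-rational point" needs the moduli interpretation of `X(s3,b5)`, `X(b3,b5)` (no carrier in the
  tree); part (2) is the form the requesting route consumes.
* Weak forms `….isModularEllipticCurve` (trace-only Caraiani–Newton rendering, the notion the
  summit-side route files write out) via the proved bridges of `TotallyRealModularity.lean`.

## References

* [Thorne2016] Math. Ann. 364 (2016) 589–648, Thm. 7.6 (= Thm. 1.1), §1 (definition of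
  modular) — held `paper:arxiv-1504.00994`, pp. 3 and 37 of the text.
* [Thorne2019] J. Eur. Math. Soc. 21 (2019) 1943–1948, doi:10.4171/jems/877, Thm. 2, Lemma 3,
  Prop. 4 (§2) — held `paper:arxiv-1505.04769`, p. 4 of the text.
* [FreitasLeHungSiksek2015] Invent. Math. 201 (2015), Thm. 3 (`p = 3`), Lemmas 5.6–5.7 (the
  models, as cited by Thorne's Prop. 4 "See [Fre13]"); [Box2022] Thm. 1.3 (ii);
  [CaraianiNewton2023] §7 (the Legendre model of `X₀(15)`).
-/

open scoped NumberField MatrixGroups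
open NumberField Field Literature.NumberTheory.GaloisRepresentations

noncomputable section

namespace Literature.NumberTheory.Automorphic

universe u

/-! ### Borel framings and reducibility of `E[p]` -/

/-- **An upper-triangular framing makes `E[p]` reducible.** If `ρ̄ : Γ_F →ₜ* GL₂(ℤ/p)` is a
framing of the Galois action on the geometric `p`-torsion of `W` (`IsTorsionGaloisRep`:
`e(σ • P) = ρ̄(σ) · e(P)` for an additive isomorphism `e : E[p] ≃ (ℤ/p)²`) whose matrices all have
vanishing entry `(1,0)`, then the line `{P ; e(P) 1 = 0}` (the span of `e⁻¹(1,0)`) is a proper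
non-zero `Γ_F`-stable subgroup, so `E[p]` is not irreducible
(`WeierstrassCurve.HasIrreducibleModPGaloisRep`). This is "`E` has an `F`-rational `p`-isogeny
⇒ `ρ̄_{E,p}` is reducible" (Thorne 2016, proof of Thm. 7.6; Silverman, *AEC* III.§7). [folklore] -/
theorem not_hasIrreducibleModPGaloisRep_of_isTorsionGaloisRep_borel {F : Type u} [Field F]
    {W : WeierstrassCurve F} {p : ℕ} [Fact p.Prime] {ρ : FramedGaloisRep F (ZMod p) 2}
    (hρ : W.IsTorsionGaloisRep p ρ)
    (hB : ∀ σ : absoluteGaloisGroup F,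
      ((ρ σ : GL (Fin 2) (ZMod p)) : Matrix (Fin 2) (Fin 2) (ZMod p)) 1 0 = 0) :
    ¬ W.HasIrreducibleModPGaloisRep p := by
  intro hirr
  obtain ⟨e, he⟩ := hρ
  -- the `Γ_F`-stable line `{P ; e(P) 1 = 0}`
  let H : AddSubgroup (W.geomTorsion p) :=
    { carrier := {P | e P 1 = 0}
      zero_mem' := by simp
      add_mem' := fun {a b} ha hb => by
        simp only [Set.mem_setOf_eq, map_add, Pi.add_apply] at ha hb ⊢
        rw [ha, hb, add_zero]
      neg_mem' := fun {a} ha => by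
        simp only [Set.mem_setOf_eq, map_neg, Pi.neg_apply] at ha ⊢
        rw [ha, neg_zero] }
  have hmem : ∀ P, P ∈ H ↔ e P 1 = 0 := fun P => Iff.rfl
  have hH : ∀ σ : absoluteGaloisGroup F, ∀ P ∈ H, σ • P ∈ H := by
    intro σ P hP
    rw [hmem] at hP ⊢
    rw [he σ P, Matrix.mulVec, dotProduct, Fin.sum_univ_two, hB σ, hP, zero_mul, mul_zero,
      add_zero]
  rcases hirr H hH with h0 | h1
  · have h : e.symm (Pi.single 0 1) ∈ H := by
      rw [hmem, e.apply_symm_apply]; simp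
    rw [h0, AddSubgroup.mem_bot, e.symm_apply_eq, map_zero] at h
    have h' := congrFun h 0
    simp at h'
  · have h : e.symm (Pi.single 1 1) ∈ H := by rw [h1]; exact AddSubgroup.mem_top _
    rw [hmem, e.apply_symm_apply] at h
    simp at h

/-! ### Thorne 2016, Theorem 7.6 -/

/-- **Thorne (2016), Theorem 7.6 (= Thm. 1.1): modularity of elliptic curves without an
`F`-rational `5`-isogeny over totally real fields in which `5` is not a square.** "Let `F` be a
totally real number field, and let `E` be an elliptic curve over `F`. Suppose that: 5 is not a
square in `F`; and `E` has no `F`-rational 5-isogeny. Then `E` is modular." Rendered (module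
docstring): for `F` totally real with `¬ IsSquare (5 : F)` and an integral model `E / 𝓞 F` with
`Δ(E) ≠ 0` whose base change has irreducible mod-`5` representation
(`HasIrreducibleModPGaloisRep 5` — "equivalent to" no `F`-rational `5`-isogeny, loc. cit.),
`IsAutomorphicOfWeightZero E`. In the tree this is a consequence of the named fact
`Box2022_theorem1_3` (ii) (Box's restatement of Thorne's theorem: a non-modular `E` over `F` with
`√5 ∉ F` has a framing of `E[5]` with image in `B(5)`) and of
`not_hasIrreducibleModPGaloisRep_of_isTorsionGaloisRep_borel`.
[cite: Thorne2016, Thm. 7.6] -/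
theorem Thorne2016_theorem7_6 (hB : Box2022_theorem1_3) (F : Type) [Field F] [NumberField F]
    [IsTotallyReal F] (h5 : ¬ IsSquare (5 : F)) (E : WeierstrassCurve (𝓞 F)) (hΔ : E.Δ ≠ 0)
    (hirr : (E.baseChange F).HasIrreducibleModPGaloisRep 5) : IsAutomorphicOfWeightZero E := by
  by_contra hne
  obtain ⟨ρ, hρ, hbor⟩ := (hB F E hΔ hne).2.1 h5
  haveI : Fact (Nat.Prime 5) := ⟨by norm_num⟩
  exact not_hasIrreducibleModPGaloisRep_of_isTorsionGaloisRep_borel hρ hbor hirr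

/-- Thorne 2016, Thm. 7.6 with the trace-only conclusion `IsModularEllipticCurve F E` of
Caraiani–Newton (the notion the `Langlands` route files write out), via the proved bridges
`IsHilbertModular.of_isAutomorphicOfWeightZero`, `IsHilbertModular.isModularEllipticCurve`.
[cite: Thorne2016, Thm. 7.6] -/
theorem Thorne2016_theorem7_6_isModularEllipticCurve (hB : Box2022_theorem1_3) (F : Type)
    [Field F] [NumberField F] [IsTotallyReal F] (h5 : ¬ IsSquare (5 : F))
    (E : WeierstrassCurve (𝓞 F)) (hΔ : E.Δ ≠ 0)
    (hirr : (E.baseChange F).HasIrreducibleModPGaloisRep 5) : IsModularEllipticCurve F E :=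
  (IsHilbertModular.of_isAutomorphicOfWeightZero hΔ
    (Thorne2016_theorem7_6 hB F h5 E hΔ hirr)).isModularEllipticCurve

/-! ### Thorne 2019, Theorem 2 -/

/-- **Thorne (2019), Theorem 2.** "Let `E` be an elliptic curve over a totally real number field
`F`, and suppose that (at least) one of the following is true: The representation
`ρ̄_{E,3}|_{G_{F(ζ₃)}}` is absolutely irreducible. `√5 ∉ F`, and `ρ̄_{E,5}` is irreducible. Then
`E` is modular." Rendered: first bullet = `ModPImageAbsIrreducibleOverCyclotomic (E ⊗ F) 3`
(every framing, every model of `F(ζ₃)`; file `TotallyRealModularityLargeImage`), second bullet =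
`¬ IsSquare (5 : F) ∧ HasIrreducibleModPGaloisRep 5`; conclusion `IsAutomorphicOfWeightZero E`
for an integral model with `Δ ≠ 0`. As printed, the first part is [Fre13] (here the named fact
`FLS2015_theorems3_4` at `p = 3`) and the second is Thorne 2016 (`Thorne2016_theorem7_6`, from
`Box2022_theorem1_3`). [cite: Thorne2019, Thm. 2] -/
theorem Thorne2019_theorem2 (h34 : FLS2015_theorems3_4) (hB : Box2022_theorem1_3) (F : Type)
    [Field F] [NumberField F] [IsTotallyReal F] (E : WeierstrassCurve (𝓞 F)) (hΔ : E.Δ ≠ 0)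
    (h : (letI : Fact (Nat.Prime 3) := ⟨by norm_num⟩
          ModPImageAbsIrreducibleOverCyclotomic (E.baseChange F) 3) ∨
      (¬ IsSquare (5 : F) ∧ (E.baseChange F).HasIrreducibleModPGaloisRep 5)) :
    IsAutomorphicOfWeightZero E := by
  rcases h with h3 | ⟨h5, hirr⟩
  · haveI : Fact (Nat.Prime 3) := ⟨by norm_num⟩
    exact h34 F E hΔ 3 (Or.inl rfl) h3
  · exact Thorne2016_theorem7_6 hB F h5 E hΔ hirr

/-! ### Thorne 2019, Proposition 4: the models `E₁ = X(b3, b5) = X₀(15)` and `E₂ = X(s3, b5)` -/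

namespace Thorne2019

/-- `E₁ : y² + xy + y = x³ + x² - 10x - 10`, Cremona 15A1, the `ℚ`-model of `X(b3, b5) = X₀(15)`
printed in Thorne 2019, Prop. 4 (`[a₁, a₂, a₃, a₄, a₆] = [1, 1, 1, -10, -10]`; `ℚ`-isomorphic to
the Legendre model `X0FifteenLegendre`, `variableChange_X0FifteenLegendre_eq_cremona15a1`).
[cite: Thorne2019, Prop. 4] -/
def curveE1 : WeierstrassCurve ℚ := ⟨1, 1, 1, -10, -10⟩

/-- `E₂ : y² + xy + y = x³ + x² - 5x + 2`, Cremona 15A3, the `ℚ`-model of `X(s3, b5)` printed in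
Thorne 2019, Prop. 4 (`[a₁, a₂, a₃, a₄, a₆] = [1, 1, 1, -5, 2]`), `2`-isogenous to `E₁` over `ℚ`.
[cite: Thorne2019, Prop. 4] -/
def curveE2 : WeierstrassCurve ℚ := ⟨1, 1, 1, -5, 2⟩

/-- `Δ(E₁) = 50625 = 3⁴ · 5⁴` (Thorne 2019, proof of Thm. 5: "`E` has minimal discriminant
`15⁴`"; tree `cremona15a1_Δ`). [cite: Thorne2019, Prop. 4 and proof of Thm. 5] -/
theorem curveE1_Δ : curveE1.Δ = 50625 := cremona15a1_Δ

/-- `Δ(E₂) = 225 = 3² · 5²` (tree `cremona15a3_Δ`). [folklore] -/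
theorem curveE2_Δ : curveE2.Δ = 225 := cremona15a3_Δ

/-- `E₁` is an elliptic curve (`Δ = 50625 ≠ 0`). [folklore] -/
instance curveE1.isElliptic : curveE1.IsElliptic := by
  rw [WeierstrassCurve.isElliptic_iff, curveE1_Δ]; norm_num

/-- `E₂` is an elliptic curve (`Δ = 225 ≠ 0`). [folklore] -/
instance curveE2.isElliptic : curveE2.IsElliptic := by
  rw [WeierstrassCurve.isElliptic_iff, curveE2_Δ]; norm_num

/-- The printed Legendre model of `X₀(15)` is carried to `E₁` by the change of variables
`(u, r, s, t) = (2, -12, 1, 4)` (restating `variableChange_X0FifteenLegendre_eq_cremona15a1` for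
the named curve). [cite: Thorne2019, Prop. 4] -/
theorem variableChange_X0FifteenLegendre_eq_curveE1 :
    (⟨Units.mk0 2 two_ne_zero, -12, 1, 4⟩ : WeierstrassCurve.VariableChange ℚ) •
        X0FifteenLegendre = curveE1 :=
  variableChange_X0FifteenLegendre_eq_cremona15a1

end Thorne2019

/-! ### Thorne 2019, Lemma 3 (2): the named fact -/

/-- **Thorne (2019), Lemma 3 (2) with Prop. 4: over a cyclic totally real field without `√5` in
which `X₀(15)` and `X(s3, b5)` have only their rational points, every elliptic curve is
modular.** "Let `F` be a totally real field such that `√5 ∉ F`. […] (2) If `F/ℚ` is cyclic and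
`X(s3, b5)(F) = X(s3, b5)(ℚ)`, `X(b3, b5)(F) = X(b3, b5)(ℚ)`, then all elliptic curves over `F`
are modular"; Prop. 4: "`X(b3, b5)` is isomorphic over `ℚ` to the elliptic curve
`E₁ : y² + xy + y = x³ + x² - 10x - 10` […] `X(s3, b5)` is isomorphic over `ℚ` to the elliptic
curve `E₂ : y² + xy + y = x³ + x² - 5x + 2`". Rendered (module docstring): `F` a totally real
number field with `¬ IsSquare (5 : F)`, Galois over `ℚ` with cyclic Galois group; the hypotheses
`X(b3,b5)(F) = X(b3,b5)(ℚ)`, `X(s3,b5)(F) = X(s3,b5)(ℚ)` as "every affine `F`-point of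
`E₁ = Thorne2019.curveE1`, resp. `E₂ = Thorne2019.curveE2`, has both coordinates in `ℚ`";
conclusion: every integral Weierstrass model `E / 𝓞 F` with `Δ(E) ≠ 0` is automorphic of weight
zero (`IsAutomorphicOfWeightZero`, the rendering of "modular" of `TotallyRealModularity.lean`;
Thorne: "a regular algebraic automorphic representation `π` of `GL₂(𝔸_F)` which has the same
`L`-function as `E`"). The printed proof (Lemma 3 (1): a non-modular `E` gives an `F`-point of
`X(s3,b5)` or `X(b3,b5)`, via Thm. 2 and [Fre13]; then that point is rational, so `j(E) ∈ ℚ`,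
modularity over `ℚ` and cyclic base change [Lan80]) uses the moduli interpretation of the two
modular curves, which has no carrier in the tree: a named fact (D-0014), users take
`(h : Thorne2019_lemma3_2)`. [cite: Thorne2019, Lemma 3 (2) and Prop. 4] -/
def Thorne2019_lemma3_2 : Prop :=
  ∀ (F : Type) [Field F] [NumberField F] [IsTotallyReal F], ¬ IsSquare (5 : F) →
    IsGalois ℚ F → IsCyclic (F ≃ₐ[ℚ] F) →
    (∀ x y : F, (Thorne2019.curveE1.baseChange F).toAffine.Nonsingular x y →
      x ∈ Set.range (algebraMap ℚ F) ∧ y ∈ Set.range (algebraMap ℚ F)) →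
    (∀ x y : F, (Thorne2019.curveE2.baseChange F).toAffine.Nonsingular x y →
      x ∈ Set.range (algebraMap ℚ F) ∧ y ∈ Set.range (algebraMap ℚ F)) →
    ∀ E : WeierstrassCurve (𝓞 F), E.Δ ≠ 0 → IsAutomorphicOfWeightZero E

/-- Thorne 2019, Lemma 3 (2) with the trace-only conclusion `IsModularEllipticCurve F E` of
Caraiani–Newton (the shape of the conclusion of
`Summit.Langlands.Langlands.Theses.HeptagonalTower.OddDegreeDoor`), via the proved bridges.
[cite: Thorne2019, Lemma 3 (2) and Prop. 4] -/
theorem Thorne2019_lemma3_2.isModularEllipticCurve (h : Thorne2019_lemma3_2) (F : Type) [Field F]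
    [NumberField F] [IsTotallyReal F] (h5 : ¬ IsSquare (5 : F)) (hG : IsGalois ℚ F)
    (hC : IsCyclic (F ≃ₐ[ℚ] F))
    (h1 : ∀ x y : F, (Thorne2019.curveE1.baseChange F).toAffine.Nonsingular x y →
      x ∈ Set.range (algebraMap ℚ F) ∧ y ∈ Set.range (algebraMap ℚ F))
    (h2 : ∀ x y : F, (Thorne2019.curveE2.baseChange F).toAffine.Nonsingular x y →
      x ∈ Set.range (algebraMap ℚ F) ∧ y ∈ Set.range (algebraMap ℚ F))
    (E : WeierstrassCurve (𝓞 F)) (hΔ : E.Δ ≠ 0) : IsModularEllipticCurve F E :=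
  (IsHilbertModular.of_isAutomorphicOfWeightZero hΔ
    (h F h5 hG hC h1 h2 E hΔ)).isModularEllipticCurve

end Literature.NumberTheory.Automorphic

end
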